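import Literature.MathematicalPhysics.QuantumFieldTheory.Balaban1983to89.B9Cor36CubeSandwichQ
import Literature.MathematicalPhysics.QuantumFieldTheory.Balaban1983to89.B9Cor36CinvCubeLocLetter
import Literature.MathematicalPhysics.QuantumFieldTheory.Balaban1983to89.B9CubeCoarsening
import Literature.MathematicalPhysics.QuantumFieldTheory.Balaban1983to89.B9GeoLemma21KLevelV1

/-!
# `Balaban1983to89.B9Cor36CubeKernelComparison` — THE COMPARISON `hcmp` OF FILES E2-2 ∕ E2-3a: ON THE TWIN BLOCKS OF A COVER CUBE THE MEMBER'S (2.46) DISTANCE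
# (def-Y's `geo9K i` read through a section `ιB`) IS AT MOST THE CUBE SEQUENCE'S (p33's `geoCK i □`) AND THE BLOCK SCALES AGREE — so an exponential block
# majorant over the cube geometry dominates the member-currency kernel of M5.6 (sub-row G-B9-LETTERS, module M5.2-E, FILE E2-5a; design (β))

T. Bałaban, *Propagators for lattice gauge theories in a background field*, Commun. Math. Phys. **99** (1985) 389–434
[`Balaban1985BackgroundPropagators`, "B9"]; [4] = T. Bałaban, *Propagators and renormalization transformations for lattice gauge
theories. II*, Commun. Math. Phys. **96** (1984) 223–250 [`Balaban1984PropagatorsII`].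

statement-level skeleton of published theorems with citation tags; proofs where landed; nothing here is a claim about the
Yang–Mills mass gap

THE PRINTED LOCUS (verbatim, held `paper:balaban1985-cmp99-background-propagators`, journal page = PDF page + 388).  p. 409 l. 6–9: *«|(K(h_□)G′_□h_□λ)(x)| ≦ O(M⁻¹)
e^{−δ₀(Lʲη)⁻¹|y−y′|}|λ| (3.89) for x ∈ Δ(y), supp λ ⊂ Δ(y′), y, y′ ∈ □ ∈ 𝒟_j.  It is exactly the bound (2.44) of [4]»* — the cube letters' bounds are READ in the member's
blocks; p. 408 (*«Ω_n(□) … This sequence satisfies the conditions (2.1), (2.2) with j instead of k»*); [4] (2.45)–(2.46) p. 231 (the multiscale distance), (2.51) p. 232.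

WHY THIS FILE.  FILES E2-2 (`hasMajorant_conj_smul_cinvLocLetterY`) and E2-3a (`hasMajorant_conj_cinvLocDefectY`) carry a cube-side block majorant `K_C` to M5.6's member
geometry through ONE comparison hypothesis `hcmp : ∀ s s′ ∈ N (twins), c·K_C(σs, σs′) ≦ K(τs, τs′)`.  With `σ := id` (sites of `geoCK i □`) and `τ⟨s.1, hs⟩ := ιB ⟨s.1, hs⟩`
(M5.6's section of def-Y's `geo9K i`), THIS FILE proves the two geometric facts behind it and packages `hcmp` for the two kernel shapes in use:
* ★ `coarsen_eq_of_val_mem` (r05's member block of a twin cube block IS the twin), ★★ `geo9K_dist_ιB_le_geoCK_dist` (`d_member(τs, τs′) ≦ d_□(s, s′)` — r05's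
  `B9CubeCoarsening.dist_coarsen_le`: coarsening contracts (2.46)), ★ `geo9K_len_ιB_eq_geoCK_len` (`ℓ_member(τs) = ℓ_□(s) = L^{j(s)}η`);
* ★★ `hcmp_len4` (the `hC` shape `B·ℓ^{−4}·e^{−δd}` of E2-2 against M5.6's `B₀·(ℓ⁴)⁻¹·e^{−b_bδ₀d}`), ★★ `hcmp_exp` (the `hEd` shape of E2-3a).

HONEST SCOPE.  Geometry∕bookkeeping over r05's, p33's and def-Y's DEFINED objects; no inequality of the papers.  Count-neutral; no summit ∕ sub-problem statement is proved;
nothing continuum ∕ OS ∕ mass-gap ∕ Clay.  No `sorry`, no `axiom`, no `… : Prop` fact, no `instance`, no `notation`, no `def`.  NEW file; nothing landed is modified.  Cell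
`lit-balaban`, seat `lit-balaban-p21` gen 34, 2026-08-28; `--supports stmt-QuantumFields-19200` as helper.  Net new unproved facts: 0.

RELATED IN THE TREE, NOT DUPLICATED (searched 2026-08-28): r05 `B9CubeCoarsening` (`coarsen`, `dist_coarsen_le`, `coarsen_blkOf` — USED), p33 `B9CubeGeometryInputs` (`geoCK`,
`geoCK_dist`, `geoCK_len`), def-Y ∕ p21 `B9GeoLemma21KLevelV1.geo9K_dist_eq`, `B6KLevelCensusIndexV1.len_eq`, `B6Ineq2142KLevelV1.beta_level`, p33 `B9B8KnitLetterE12Sup.geo9K_len_ιB_blkOf`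
(the `blkOf z` case of the length identity; ours is the twin-block case), p21 E2-1 `blkOf_val_eq_of_mem` — no existing module modified.
-/

noncomputable section

namespace Literature.MathematicalPhysics.QuantumFieldTheory.Balaban1983to89.B9Cor36CubeKernelComparison

open B6KLevelCensusIndexV1 (KIdx kGeo len_eq)
open B6Cover236MultiLevelBlocks (cubes)
open B6Geom246MultiLevelBox (bset blkOf)
open B6Geom246MultiLevelTorus (bondT)
open B6Ineq2142KLevelV1 (β lvl beta_level)
open B9GeoNormsKLevelV1 (geo9K geo9K_len_kGeo)
open B9GeoLemma21KLevelV1 (geo9K_dist_eq)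
open B9CubeLettersOpsL0 (cubeFamY)
open B9CubeLettersBondOpsL0 (BlkCubeY)
open B9CubeCoarsening (coarsen coarsen_blkOf dist_coarsen_le)
open B9CubeGeometryInputs (geoCK geoCK_dist geoCK_len geoCK_len_pos)
open B9Cor36CinvCubeLocLetter (blkOf_val_eq_of_mem)
open Node00 (SiteY BlkY IBondY toKT)

variable {d ℓ : ℕ} {hd : 1 ≤ d + 1} {hL : Odd (ℓ + 1) ∧ 1 < ℓ + 1} {b₀ b₁ : ℝ}
variable (i : KIdx d ℓ hd hL b₀ b₁) (c : ↥(cubes (toKT i).D.toDomains)) (ιB : BlkY i → IBondY i)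

/-- ★ **THE MEMBER BLOCK OF A TWIN CUBE BLOCK IS THE TWIN**: if the data `(level, label)` of a cube block `s` is also a member block, r05's `coarsen s` is that member block.
[cite: Balaban1985BackgroundPropagators, p.408 (□̃³ ⊂ Ω_j(□) = □̃⁴); Balaban1984PropagatorsII, (2.45) p.231] -/
theorem coarsen_eq_of_val_mem (s : BlkCubeY i c) (hs : s.1 ∈ bset i.D.toDomains) :
    coarsen (D := (toKT i).D) (q := c) (hL := hL.1) (hM := B9CubeLettersOpsL0.oddMh i) (hMh := (toKT i).hMh) (hP := (toKT i).hP) s = ⟨s.1, hs⟩ := by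
  have hcorner := B6Geom246MultiLevelBoxL0.blkOf_corner (cubeFamY i c).toDomains s
  have hs' : (B6Geom246MultiLevelBoxL0.blkOf (cubeFamY i c).toDomains
      ⟨B6Geom246MultiLevelBoxL0.corner (cubeFamY i c).toDomains s, B6Geom246MultiLevelBoxL0.corner_mem (cubeFamY i c).toDomains s⟩).1 ∈ bset i.D.toDomains := by
    rw [hcorner]; exact hs
  have e := blkOf_val_eq_of_mem i c hs'
  rw [hcorner] at e
  calc coarsen (D := (toKT i).D) (q := c) (hL := hL.1) (hM := B9CubeLettersOpsL0.oddMh i) (hMh := (toKT i).hMh) (hP := (toKT i).hP) s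
      = coarsen (D := (toKT i).D) (q := c) (hL := hL.1) (hM := B9CubeLettersOpsL0.oddMh i) (hMh := (toKT i).hMh) (hP := (toKT i).hP)
          (B6Geom246MultiLevelBoxL0.blkOf (cubeFamY i c).toDomains
            ⟨B6Geom246MultiLevelBoxL0.corner (cubeFamY i c).toDomains s, B6Geom246MultiLevelBoxL0.corner_mem (cubeFamY i c).toDomains s⟩) := by rw [hcorner]
    _ = blkOf (toKT i).D.toDomains ⟨B6Geom246MultiLevelBoxL0.corner (cubeFamY i c).toDomains s, B6Geom246MultiLevelBoxL0.corner_mem (cubeFamY i c).toDomains s⟩ :=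
        coarsen_blkOf _
    _ = ⟨s.1, hs⟩ := Subtype.ext e

/-- ★★ **THE MEMBER'S (2.46) DISTANCE BETWEEN TWINS IS AT MOST THE CUBE SEQUENCE'S** (coarsening contracts admissible contours — r05's `dist_coarsen_le`), read through M5.6's
section `ιB` of def-Y's `geo9K i`. [cite: Balaban1984PropagatorsII, (2.46) p.231; Balaban1985BackgroundPropagators, p.409 l.6–9 ((3.89) read in the member's Δ(y))] -/
theorem geo9K_dist_ιB_le_geoCK_dist (hι : ∀ s, β i.hN i.D i.hk (ιB s) = s) (s s' : BlkCubeY i c) (hs : s.1 ∈ bset i.D.toDomains) (hs' : s'.1 ∈ bset i.D.toDomains) :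
    (geo9K i).dist (ιB ⟨s.1, hs⟩) (ιB ⟨s'.1, hs'⟩) ≤ (geoCK i c).dist s s' := by
  have h := dist_coarsen_le (D := (toKT i).D) (q := c) (hL := hL.1) (hM := B9CubeLettersOpsL0.oddMh i) (toKT i).hMh (toKT i).hP s s'
  rw [coarsen_eq_of_val_mem i c s hs, coarsen_eq_of_val_mem i c s' hs'] at h
  rw [geo9K_dist_eq, hι, hι, geoCK_dist]
  exact_mod_cast h

/-- ★ **THE BLOCK SCALES AGREE ON TWINS**: `ℓ_member(ιB s) = L^{j(s)}η = ℓ_□(s)`. [cite: Balaban1984PropagatorsII, (2.1) p.224; Balaban1985BackgroundPropagators, (3.41) p.397] -/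
theorem geo9K_len_ιB_eq_geoCK_len (hι : ∀ s, β i.hN i.D i.hk (ιB s) = s) (s : BlkCubeY i c) (hs : s.1 ∈ bset i.D.toDomains) :
    (geo9K i).len (ιB ⟨s.1, hs⟩) = (geoCK i c).len s := by
  have hk1 : 1 ≤ i.k := le_trans (by norm_num) i.hk2
  rw [geo9K_len_kGeo, len_eq i, ← beta_level i.hN i.D i.hk hk1, hι, geoCK_len, div_eq_mul_inv, Nat.cast_add, Nat.cast_one]

/-- ★★ **`hcmp` FOR THE (3.48) SHAPE** (FILE E2-2's `hC` input against M5.6's `B₀·(ℓ⁴)⁻¹·e^{−bδ₀d}`): with `B′ ≦ B₀` and `b′ ≦ δ`, on twins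
`B′·ℓ_□(s)^{−4}·e^{−δ d_□(s,s′)} ≦ B₀·(ℓ_member(ιB s)⁴)⁻¹·e^{−b′ d_member(ιB s, ιB s′)}`. [cite: Balaban1985BackgroundPropagators, Thm 3.2 (3.48) p.398, p.409 l.6–9; Balaban1984PropagatorsII, (2.46) p.231] -/
theorem hcmp_len4 (hι : ∀ s, β i.hN i.D i.hk (ιB s) = s) {B' B₀ δ b' : ℝ} (hB : B' ≤ B₀) (hB' : 0 ≤ B') (hb : b' ≤ δ) (hb' : 0 ≤ b')
    (s s' : BlkCubeY i c) (hs : s.1 ∈ bset i.D.toDomains) (hs' : s'.1 ∈ bset i.D.toDomains) :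
    B' * (geoCK i c).len s ^ (-(4 : ℝ)) * Real.exp (-(δ * (geoCK i c).dist s s')) ≤
      B₀ * ((geo9K i).len (ιB ⟨s.1, hs⟩) ^ 4)⁻¹ * Real.exp (-(b' * (geo9K i).dist (ιB ⟨s.1, hs⟩) (ιB ⟨s'.1, hs'⟩))) := by
  have hlen := geoCK_len_pos i c s
  have hd := geo9K_dist_ιB_le_geoCK_dist i c ιB hι s s' hs hs'
  have hd0 : 0 ≤ (geo9K i).dist (ιB ⟨s.1, hs⟩) (ιB ⟨s'.1, hs'⟩) := by rw [geo9K_dist_eq]; exact Nat.cast_nonneg _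
  rw [geo9K_len_ιB_eq_geoCK_len i c ιB hι s hs, Real.rpow_neg hlen.le, show ((4 : ℝ)) = ((4 : ℕ) : ℝ) by norm_num, Real.rpow_natCast]
  have h4 : 0 ≤ ((geoCK i c).len s ^ 4)⁻¹ := inv_nonneg.2 (pow_nonneg hlen.le 4)
  refine mul_le_mul (mul_le_mul_of_nonneg_right hB h4) (Real.exp_le_exp.2 ?_) (Real.exp_nonneg _) (mul_nonneg (hB'.trans hB) h4)
  nlinarith [mul_le_mul hb hd hd0 (hb'.trans hb)]

/-- ★★ **`hcmp` FOR THE PURE-EXPONENTIAL SHAPE** (FILE E2-3a's `hEd` input against M5.6's `κ_E·e^{−a_Xδ₀D}·e^{−a_Eδ₀d}`): with `κ′ ≦ κ`, `a′ ≦ ρ`, on twins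
`κ′·e^{−ρ d_□(s,s′)} ≦ κ·e^{−a′ d_member(ιB s, ιB s′)}`. [cite: Balaban1985BackgroundPropagators, (3.95) p.411, p.409 l.6–9; Balaban1984PropagatorsII, (2.46) p.231] -/
theorem hcmp_exp (hι : ∀ s, β i.hN i.D i.hk (ιB s) = s) {κ' κ ρ a' : ℝ} (hκ : κ' ≤ κ) (hκ' : 0 ≤ κ') (ha : a' ≤ ρ) (ha' : 0 ≤ a')
    (s s' : BlkCubeY i c) (hs : s.1 ∈ bset i.D.toDomains) (hs' : s'.1 ∈ bset i.D.toDomains) :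
    κ' * Real.exp (-(ρ * (geoCK i c).dist s s')) ≤ κ * Real.exp (-(a' * (geo9K i).dist (ιB ⟨s.1, hs⟩) (ιB ⟨s'.1, hs'⟩))) := by
  have hd := geo9K_dist_ιB_le_geoCK_dist i c ιB hι s s' hs hs'
  have hd0 : 0 ≤ (geo9K i).dist (ιB ⟨s.1, hs⟩) (ιB ⟨s'.1, hs'⟩) := by rw [geo9K_dist_eq]; exact Nat.cast_nonneg _
  refine mul_le_mul hκ (Real.exp_le_exp.2 ?_) (Real.exp_nonneg _) (hκ'.trans hκ)
  nlinarith [mul_le_mul ha hd hd0 (ha'.trans ha)]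

end Literature.MathematicalPhysics.QuantumFieldTheory.Balaban1983to89.B9Cor36CubeKernelComparison

end
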